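import Literature.NumberTheory.Automorphic.AutomorphicKernelL1
import Literature.MeasureTheory.Group.BruhatFunction
import HarnessLib

/-!
# Integrals over `G ⧸ H` through a Bruhat function: the unfolded bilinear form
# `∫_G F(g) ⟨ψ̄, R(g) φ⟩ dg` as an iterated integral over `G × G`

Topic `NumberTheory/Automorphic`; namespace `Literature.NumberTheory.Automorphic`. Continuation of
`AutomorphicKernelL1` with the Bruhat functions of `Literature.MeasureTheory.Group.BruhatFunction`:
for a closed subgroup `H` of a second countable locally compact Hausdorff group `G`, a left
invariant `ρ` on `H`, a `G`-invariant `μ` on `G ⧸ H` (both finite on compacts) and a Haar measure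
`ν` on `G` with `c = unfoldingConstant H ρ μ ν ≠ 0`:

* `measure_preimage_mk_null`, `quasiMeasurePreserving_mk`, `ae_comp_mk_of_ae` — **`π : G → G ⧸ H`
  is quasi-measure-preserving** (`μ N = 0 ⇒ ν (π⁻¹ N) = 0`, from `liftMeasure = c ν`), so `μ`-a.e.
  statements lift to `ν`-a.e. statements;
* `integral_eq_smul_integral_bruhat` — **`∫_{G ⧸ H} u dμ = c ∫_G β(g) u(gH) dν(g)`** for
  `u ∈ L¹(G ⧸ H)` Banach-valued and a Bruhat function `β` (Weil's formula for `β · (u ∘ π)`);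
  `lintegral_eq_mul_lintegral_bruhat` (the `ℝ≥0∞` version for a.e.-measurable `u`),
  `integrable_bruhat_smul_comp_mk`;
* `integrable_mul_orbitalSmoothing`, `ae_integrable_cosetKernel_mul` — the integrability facts of the
  Fubini unfolding of `AutomorphicKernelL1`;
* `integral_mul_integral_mul_comp_smul_eq_integral_bruhat` and
  `integral_mul_integral_mul_comp_smul_eq_mul_integral_integral_bruhat` — **the unfolded bilinear
  form with the lifts as integration variables on the group**: for `F ∈ L¹(G)`,
  `φ ∈ L¹ ∩ L²(G ⧸ H)`, `ψ ∈ L²(G ⧸ H)` strongly measurable and `ν` inversion invariant,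
  `∫_G F(g) (∫ ψ(x) φ(g⁻¹ • x) dμ) dν(g) = c ∫_G β(x̃) ψ(x̃H) ∫_G β(ỹ) K_F(x̃, ỹH) φ(ỹH) dν(ỹ) dν(x̃)`,
  `K_F(x̃, ỹH) = ∫_H F(x̃ h⁻¹ ỹ⁻¹) dρ(h)` (`cosetKernel`), together with the integrability of the
  inner (`ae_integrable_bruhat_mul_cosetKernel_mul`) and outer
  (`integrable_bruhat_mul_mul_integral_bruhat_cosetKernel`) integrands.

This replaces the measurable-section lift `Quotient.out` of
`integral_mul_integral_mul_comp_smul_eq_inv_mul_integral_cosetKernel` by honest integration variables,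
so that fibrewise identities between kernels (Poisson summation in the Godement–Jacquet method,
LNM 260 §12) can be integrated with the ordinary Fubini–Tonelli theorems on `G × G`. Everything is
proved; no definitions.

## References

* G. B. Folland, *A Course in Abstract Harmonic Analysis* (1995), §2.6, Prop. 2.48, Thm. 2.49
  [Folland1995].
* R. Godement, H. Jacquet, *Zeta functions of simple algebras*, LNM 260 (1972), §12
  [GodementJacquet1972].
-/

noncomputable section

open MeasureTheory Measure Set Filter Topology
open Literature.MeasureTheory.Group
open scoped ENNReal NNReal Pointwise ComplexConjugate

namespace Literature.NumberTheory.Automorphic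

-- the coset space carries the Borel σ-algebra supplied by the user, not the quotient σ-algebra
attribute [-instance] Quotient.instMeasurableSpace QuotientGroup.measurableSpace

section Transfer

variable {G : Type*} [Group G] [TopologicalSpace G] [IsTopologicalGroup G] [LocallyCompactSpace G]
  [SecondCountableTopology G] [T2Space G] [MeasurableSpace G] [BorelSpace G]
  (H : Subgroup G) [hH : IsClosed (H : Set G)]
  (ρ : Measure H) [ρ.IsMulLeftInvariant] [SFinite ρ] [IsFiniteMeasureOnCompacts ρ]
  [MeasurableSpace (G ⧸ H)] [BorelSpace (G ⧸ H)]
  (μ : Measure (G ⧸ H)) [SMulInvariantMeasure G (G ⧸ H) μ] [IsFiniteMeasureOnCompacts μ]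
  (ν : Measure G) [IsHaarMeasure ν]

/-- **`μ`-null sets pull back to `ν`-null sets**: `μ N = 0 ⇒ ν (π⁻¹ N) = 0` when the unfolding
constant is non-zero (`liftMeasure = c ν` and `liftMeasure (π⁻¹ N) = ρ(H) μ(N) = 0`). [folklore] -/
theorem measure_preimage_mk_null (hc : unfoldingConstant H ρ μ ν ≠ 0) {N : Set (G ⧸ H)}
    (hNm : MeasurableSet N) (hN : μ N = 0) :
    ν ((QuotientGroup.mk : G → G ⧸ H) ⁻¹' N) = 0 := by
  have hE : MeasurableSet ((QuotientGroup.mk : G → G ⧸ H) ⁻¹' N) :=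
    hNm.preimage (QuotientGroup.continuous_mk (N := H)).measurable
  have h1 : liftMeasure H ρ μ ((QuotientGroup.mk : G → G ⧸ H) ⁻¹' N) = 0 := by
    rw [liftMeasure_apply H ρ μ hE]
    have h2 : ∀ x : G ⧸ H, fiberLIntegral H ρ (((QuotientGroup.mk : G → G ⧸ H) ⁻¹' N).indicator 1) x =
        N.indicator (fun _ => ρ Set.univ) x := by
      intro x
      obtain ⟨g, rfl⟩ := QuotientGroup.mk_surjective x
      rw [fiberLIntegral_mk]
      have h3 : ∀ h : H, ((QuotientGroup.mk : G → G ⧸ H) ⁻¹' N).indicator (1 : G → ℝ≥0∞) (g * h) =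
          N.indicator (fun _ => (1 : ℝ≥0∞)) (QuotientGroup.mk g) := by
        intro h
        have hq : (QuotientGroup.mk (g * (h : G)) : G ⧸ H) = QuotientGroup.mk g :=
          QuotientGroup.mk_mul_of_mem g h.2
        by_cases hg : (QuotientGroup.mk g : G ⧸ H) ∈ N
        · rw [Set.indicator_of_mem hg, Set.indicator_of_mem (show g * (h : G) ∈ _ by
            rw [Set.mem_preimage, hq]; exact hg), Pi.one_apply]
        · rw [Set.indicator_of_notMem hg, Set.indicator_of_notMem (show g * (h : G) ∉ _ by
            rw [Set.mem_preimage, hq]; exact hg)]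
      simp_rw [h3]
      by_cases hg : (QuotientGroup.mk g : G ⧸ H) ∈ N
      · simp [Set.indicator_of_mem hg, lintegral_const]
      · simp [Set.indicator_of_notMem hg]
    simp_rw [h2]
    rw [lintegral_indicator hNm, setLIntegral_const, hN, mul_zero]
  rw [liftMeasure_eq_smul H ρ μ ν, Measure.smul_apply, smul_eq_zero] at h1
  rcases h1 with h1 | h1
  · exact absurd h1 (by exact_mod_cast hc)
  · exact h1

/-- **The quotient map is quasi-measure-preserving** from `(G, ν)` to `(G ⧸ H, μ)` (for `c ≠ 0`).
[folklore] -/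
theorem quasiMeasurePreserving_mk (hc : unfoldingConstant H ρ μ ν ≠ 0) :
    QuasiMeasurePreserving (QuotientGroup.mk : G → G ⧸ H) ν μ := by
  refine ⟨(QuotientGroup.continuous_mk (N := H)).measurable, ?_⟩
  refine Measure.AbsolutelyContinuous.mk fun N hNm hN => ?_
  rw [Measure.map_apply (QuotientGroup.continuous_mk (N := H)).measurable hNm]
  exact measure_preimage_mk_null H ρ μ ν hc hNm hN

/-- **`μ`-a.e. statements lift to `ν`-a.e. statements along `π`.** [folklore] -/
theorem ae_comp_mk_of_ae (hc : unfoldingConstant H ρ μ ν ≠ 0) {P : G ⧸ H → Prop}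
    (h : ∀ᵐ x ∂μ, P x) : ∀ᵐ g ∂ν, P (QuotientGroup.mk g) :=
  (quasiMeasurePreserving_mk H ρ μ ν hc).ae h

variable {E : Type*} [NormedAddCommGroup E] [NormedSpace ℝ E]

/-- **`β · (u ∘ π) ∈ L¹(G)` for `u ∈ L¹(G ⧸ H)`** (a.e. strongly measurable version of
`IsBruhatFunction.integrable_mul_comp_mk` of `BruhatFunction`). [folklore] -/
theorem integrable_bruhat_smul_comp_mk (hc : unfoldingConstant H ρ μ ν ≠ 0)
    {β : G → ℝ} (hβ : IsBruhatFunction H ρ β) {u : G ⧸ H → E} (hu : Integrable u μ) :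
    Integrable (fun g => β g • u (QuotientGroup.mk g)) ν := by
  have hum0 : AEStronglyMeasurable u μ := hu.aestronglyMeasurable
  have hum : AEStronglyMeasurable (fun g => u (QuotientGroup.mk g)) ν :=
    hum0.comp_quasiMeasurePreserving (quasiMeasurePreserving_mk H ρ μ ν hc)
  refine ⟨hβ.continuous.aestronglyMeasurable.smul hum, ?_⟩
  have h := hβ.lintegral_eq_mul_lintegral H ρ μ ν (u := fun x => ‖hum0.mk u x‖ₑ)
    hum0.stronglyMeasurable_mk.enorm
  have h0 : ∫⁻ x, ‖hum0.mk u x‖ₑ ∂μ = ∫⁻ x, ‖u x‖ₑ ∂μ :=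
    lintegral_congr_ae (hum0.ae_eq_mk.mono fun x hx => by simp only [hx])
  have hae : ∀ᵐ g ∂ν, u (QuotientGroup.mk g) = hum0.mk u (QuotientGroup.mk g) :=
    ae_comp_mk_of_ae H ρ μ ν hc hum0.ae_eq_mk
  have h1 : ∫⁻ g, ‖β g • u (QuotientGroup.mk g)‖ₑ ∂ν =
      ∫⁻ g, ENNReal.ofReal (β g) * ‖hum0.mk u (QuotientGroup.mk g)‖ₑ ∂ν := by
    refine lintegral_congr_ae (hae.mono fun g hg => ?_)
    simp only [enorm_smul, Real.enorm_eq_ofReal (hβ.nonneg g), hg]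
  change ∫⁻ g, ‖β g • u (QuotientGroup.mk g)‖ₑ ∂ν < ∞
  rw [h1]
  have hfin : unfoldingConstant H ρ μ ν *
      ∫⁻ g, ENNReal.ofReal (β g) * ‖hu.1.mk u (QuotientGroup.mk g)‖ₑ ∂ν < ∞ := by
    rw [← h, h0]; exact hu.2
  by_contra htop
  rw [not_lt, top_le_iff] at htop
  rw [htop, ENNReal.mul_top (by exact_mod_cast hc)] at hfin
  exact lt_irrefl _ hfin

/-- **Integration over the quotient through a Bruhat function, Bochner version**: for
`u ∈ L¹(G ⧸ H, μ)` (Banach-space valued), `∫_{G ⧸ H} u dμ = c • ∫_G β(g) u(gH) dν(g)`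
(Weil's formula `integral_fiberIntegralVec_eq_smul_integral` for `β · (u ∘ π)`, whose fibre
integrals are `u`). [cite: Folland1995, §2.6 Thm. 2.49] -/
theorem integral_eq_smul_integral_bruhat [CompleteSpace E] (hc : unfoldingConstant H ρ μ ν ≠ 0)
    {β : G → ℝ} (hβ : IsBruhatFunction H ρ β) {u : G ⧸ H → E} (hu : Integrable u μ) :
    ∫ x, u x ∂μ = (unfoldingConstant H ρ μ ν) • ∫ g, β g • u (QuotientGroup.mk g) ∂ν := by
  have hFi := integrable_bruhat_smul_comp_mk H ρ μ ν hc hβ hu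
  rw [← integral_fiberIntegralVec_eq_smul_integral H ρ μ ν hFi]
  refine integral_congr_ae (Eventually.of_forall fun x => ?_)
  obtain ⟨g, rfl⟩ := QuotientGroup.mk_surjective x
  rw [fiberIntegralVec_mk]
  have h1 : ∀ h : H, β (g * h) • u (QuotientGroup.mk (g * (h : G))) = β (g * h) • u (QuotientGroup.mk g) :=
    fun h => by rw [QuotientGroup.mk_mul_of_mem g h.2]
  simp_rw [h1]
  rw [integral_smul_const, hβ.integral_fiber g, one_smul]

/-- The `ℝ≥0∞` version with an a.e.-measurable integrand. [folklore] -/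
theorem lintegral_eq_mul_lintegral_bruhat (hc : unfoldingConstant H ρ μ ν ≠ 0)
    {β : G → ℝ} (hβ : IsBruhatFunction H ρ β) {u : G ⧸ H → ℝ≥0∞} (hu : AEMeasurable u μ) :
    ∫⁻ x, u x ∂μ = unfoldingConstant H ρ μ ν *
      ∫⁻ g, ENNReal.ofReal (β g) * u (QuotientGroup.mk g) ∂ν := by
  have hae : ∀ᵐ g ∂ν, u (QuotientGroup.mk g) = hu.mk u (QuotientGroup.mk g) :=
    ae_comp_mk_of_ae H ρ μ ν hc hu.ae_eq_mk
  rw [lintegral_congr_ae hu.ae_eq_mk, hβ.lintegral_eq_mul_lintegral H ρ μ ν hu.measurable_mk]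
  congr 1
  exact lintegral_congr_ae (hae.mono fun g hg => by simp only [hg])

end Transfer

/-! ### The unfolded bilinear form through a Bruhat function -/

section Unfolding

variable {G : Type*} [Group G] [TopologicalSpace G] [IsTopologicalGroup G] [LocallyCompactSpace G]
  [SecondCountableTopology G] [T2Space G] [MeasurableSpace G] [BorelSpace G]
  (H : Subgroup G) [hH : IsClosed (H : Set G)]
  (ρ : Measure H) [ρ.IsMulLeftInvariant] [SFinite ρ] [IsFiniteMeasureOnCompacts ρ]
  [MeasurableSpace (G ⧸ H)] [BorelSpace (G ⧸ H)]
  (μ : Measure (G ⧸ H)) [SMulInvariantMeasure G (G ⧸ H) μ] [IsFiniteMeasureOnCompacts μ] [SFinite μ]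
  (ν : Measure G) [IsHaarMeasure ν] [ν.IsInvInvariant]
  {𝕜 : Type*} [RCLike 𝕜]

omit hH [SFinite ρ] [IsFiniteMeasureOnCompacts ρ] [ρ.IsMulLeftInvariant] [T2Space G]
  [IsFiniteMeasureOnCompacts μ] [ν.IsInvInvariant] in
/-- **`ψ · S_F φ ∈ L¹(G ⧸ H)`** for `F ∈ L¹(G)`, `φ, ψ ∈ L²(G ⧸ H)` strongly measurable (the Fubini
integrability behind `integral_mul_integral_mul_comp_smul_eq`). [folklore] -/
theorem integrable_mul_orbitalSmoothing {F : G → 𝕜} (hF : Integrable F ν) {φ ψ : G ⧸ H → 𝕜}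
    (hφm : StronglyMeasurable φ) (hφ : MemLp φ 2 μ) (hψm : StronglyMeasurable ψ) (hψ : MemLp ψ 2 μ) :
    Integrable (fun x => ψ x * orbitalSmoothing ν F φ x) μ := by
  set f : G → (G ⧸ H) → 𝕜 := fun g x => F g * (ψ x * φ (g⁻¹ • x)) with hf
  have hact : Measurable fun p : G × (G ⧸ H) => p.1⁻¹ • p.2 :=
    (continuous_fst.inv.smul continuous_snd).measurable
  have hfm : AEStronglyMeasurable (Function.uncurry f) (ν.prod μ) := by
    refine AEStronglyMeasurable.mul ?_ ?_
    · exact hF.1.comp_quasiMeasurePreserving (Measure.quasiMeasurePreserving_fst (μ := ν) (ν := μ))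
    · exact ((hψm.comp_measurable measurable_snd).mul (hφm.comp_measurable hact)).aestronglyMeasurable
  set M : ℝ := ((∫ x, ‖ψ x‖ ^ 2 ∂μ) + ∫ x, ‖φ x‖ ^ 2 ∂μ) / 2 with hM
  have hfi : Integrable (Function.uncurry f) (ν.prod μ) := by
    rw [integrable_prod_iff hfm]
    constructor
    · refine Eventually.of_forall fun g => ?_
      exact ((integrable_mul_comp_smul_and_integral_le H μ hφm hφ hψm hψ g).1).const_mul (F g)
    · have hb : ∀ g, ∫ x, ‖Function.uncurry f (g, x)‖ ∂μ ≤ ‖F g‖ * M := fun g => by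
        have h1 : (fun x => ‖Function.uncurry f (g, x)‖) = fun x => ‖F g‖ * ‖ψ x * φ (g⁻¹ • x)‖ := by
          funext x
          simp [hf, norm_mul]
        rw [h1, integral_const_mul]
        exact mul_le_mul_of_nonneg_left
          (integrable_mul_comp_smul_and_integral_le H μ hφm hφ hψm hψ g).2 (norm_nonneg _)
      refine (hF.norm.mul_const M).mono' hfm.norm.integral_prod_right' (Eventually.of_forall fun g => ?_)
      rw [Real.norm_of_nonneg (integral_nonneg fun _ => norm_nonneg _)]
      exact hb g
  have h := hfi.integral_prod_right
  refine h.congr (Eventually.of_forall fun x => ?_)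
  change ∫ g, F g * (ψ x * φ (g⁻¹ • x)) ∂ν = ψ x * orbitalSmoothing ν F φ x
  simp only [orbitalSmoothing, smul_eq_mul]
  rw [← integral_const_mul]
  refine integral_congr_ae (Eventually.of_forall fun g => ?_)
  ring

/-- **For a.e. `x̃ ∈ G`, `y ↦ K_F(x̃, y) φ(y)` is integrable on `G ⧸ H`** (`F ∈ L¹(G)`, `φ ∈ L¹(G ⧸ H)`
strongly measurable; the fibre integrals of the integrable `g ↦ F(x̃ g⁻¹) φ(gH)`). [folklore] -/
theorem ae_integrable_cosetKernel_mul (hc : unfoldingConstant H ρ μ ν ≠ 0) {F : G → 𝕜} (hF : Integrable F ν)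
    {φ : G ⧸ H → 𝕜} (hφm : StronglyMeasurable φ) (hφ : Integrable φ μ) :
    ∀ᵐ x₀ ∂ν, Integrable (fun y => cosetKernel H ρ F x₀ y * φ y) μ := by
  filter_upwards [ae_comp_mk_of_ae H ρ μ ν hc (ae_integrable_comp_mul_inv_smul H μ ν hF hφm hφ)]
    with x₀ hx₀
  have hFi : Integrable (fun g : G => F (x₀ * g⁻¹) • φ (QuotientGroup.mk g)) ν := hx₀ x₀ rfl
  have h := integrable_fiberIntegralVec H ρ μ ν hFi
  refine h.congr (Eventually.of_forall fun y => ?_)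
  obtain ⟨g, rfl⟩ := QuotientGroup.mk_surjective y
  change fiberIntegralVec H ρ (fun g => F (x₀ * g⁻¹) • φ (QuotientGroup.mk g)) (QuotientGroup.mk g) =
    cosetKernel H ρ F x₀ (QuotientGroup.mk g) * φ (QuotientGroup.mk g)
  rw [fiberIntegralVec_mk, cosetKernel, fiberIntegralVec_mk]
  have e := integral_subgroup_smul_comp_mk H ρ (fun g => F (x₀ * g⁻¹)) φ g
  simp only [smul_eq_mul] at e
  exact e

/-- **The unfolded bilinear form through a Bruhat function (outer variable)**: for
`c = unfoldingConstant H ρ μ ν ≠ 0`, a Bruhat function `β`, `F ∈ L¹(G)`, `φ ∈ L¹ ∩ L²(G ⧸ H)` and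
`ψ ∈ L²(G ⧸ H)` strongly measurable,
`∫_G F(g) (∫ ψ(x) φ(g⁻¹ • x) dμ) dν(g) = ∫_G β(x̃) ψ(x̃H) (∫ K_F(x̃, y) φ(y) dμ(y)) dν(x̃)` — the
form of `integral_mul_integral_mul_comp_smul_eq_inv_mul_integral_cosetKernel` in which the lift
`x̃` is an honest integration variable on `G` (Fubini, the kernel formula for `R(F)`, and
`integral_eq_smul_integral_bruhat`). [folklore] -/
theorem integral_mul_integral_mul_comp_smul_eq_integral_bruhat (hc : unfoldingConstant H ρ μ ν ≠ 0)
    {β : G → ℝ} (hβ : IsBruhatFunction H ρ β) {F : G → 𝕜} (hF : Integrable F ν) {φ ψ : G ⧸ H → 𝕜}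
    (hφm : StronglyMeasurable φ) (hφ : MemLp φ 2 μ) (hφ1 : Integrable φ μ)
    (hψm : StronglyMeasurable ψ) (hψ : MemLp ψ 2 μ) :
    ∫ g, F g * (∫ x, ψ x * φ (g⁻¹ • x) ∂μ) ∂ν =
      ∫ x₀, (β x₀ : 𝕜) * (ψ (QuotientGroup.mk x₀) *
        ∫ y, cosetKernel H ρ F x₀ y * φ y ∂μ) ∂ν := by
  rw [integral_mul_integral_mul_comp_smul_eq H μ ν hF hφm hφ hψm hψ,
    integral_eq_smul_integral_bruhat H ρ μ ν hc hβ
      (integrable_mul_orbitalSmoothing H μ ν hF hφm hφ hψm hψ), NNReal.smul_def, ← integral_smul]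
  refine integral_congr_ae ?_
  filter_upwards [ae_comp_mk_of_ae H ρ μ ν hc
    (ae_smul_orbitalSmoothing_eq_integral_cosetKernel_smul H ρ μ ν hF hφm hφ1)] with x₀ hx₀
  have h := hx₀ x₀ rfl
  simp only [smul_eq_mul] at h
  rw [NNReal.smul_def, RCLike.real_smul_eq_coe_mul] at h
  rw [RCLike.real_smul_eq_coe_mul, RCLike.real_smul_eq_coe_mul, ← h]
  ring

/-- **The unfolded bilinear form as an iterated `G × G` integral** (both variables through the
Bruhat function): under the hypotheses of `integral_mul_integral_mul_comp_smul_eq_integral_bruhat`,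
`∫_G F(g) (∫ ψ(x) φ(g⁻¹ • x) dμ) dν(g)
   = c ∫_G β(x̃) ψ(x̃H) (∫_G β(ỹ) K_F(x̃, ỹH) φ(ỹH) dν(ỹ)) dν(x̃)`,
`K_F(x̃, ỹH) = ∫_H F(x̃ h⁻¹ ỹ⁻¹) dρ(h)` — every lift is now an integration variable on the group, and
the kernel is the honest function `cosetKernel` on `G × G` (this is the shape in which
Godement–Jacquet (1972), §12, manipulate `∫∫ φ(h) K_Φ(h, g) φ'(g)`). [folklore] -/
theorem integral_mul_integral_mul_comp_smul_eq_mul_integral_integral_bruhat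
    (hc : unfoldingConstant H ρ μ ν ≠ 0)
    {β : G → ℝ} (hβ : IsBruhatFunction H ρ β) {F : G → 𝕜} (hF : Integrable F ν) {φ ψ : G ⧸ H → 𝕜}
    (hφm : StronglyMeasurable φ) (hφ : MemLp φ 2 μ) (hφ1 : Integrable φ μ)
    (hψm : StronglyMeasurable ψ) (hψ : MemLp ψ 2 μ) :
    ∫ g, F g * (∫ x, ψ x * φ (g⁻¹ • x) ∂μ) ∂ν =
      ((unfoldingConstant H ρ μ ν : ℝ) : 𝕜) *
        ∫ x₀, (β x₀ : 𝕜) * (ψ (QuotientGroup.mk x₀) *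
          ∫ y₀, (β y₀ : 𝕜) * (cosetKernel H ρ F x₀ (QuotientGroup.mk y₀) * φ (QuotientGroup.mk y₀)) ∂ν) ∂ν := by
  rw [integral_mul_integral_mul_comp_smul_eq_integral_bruhat H ρ μ ν hc hβ hF hφm hφ hφ1 hψm hψ,
    ← integral_const_mul]
  refine integral_congr_ae ?_
  filter_upwards [ae_integrable_cosetKernel_mul H ρ μ ν hc hF hφm hφ1] with x₀ hx₀
  rw [integral_eq_smul_integral_bruhat H ρ μ ν hc hβ hx₀, NNReal.smul_def, RCLike.real_smul_eq_coe_mul]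
  simp only [RCLike.real_smul_eq_coe_mul]
  ring

/-- **Integrability of the inner Bruhat integrand**: for a.e. `x̃`,
`ỹ ↦ β(ỹ) K_F(x̃, ỹH) φ(ỹH)` is `ν`-integrable. [folklore] -/
theorem ae_integrable_bruhat_mul_cosetKernel_mul (hc : unfoldingConstant H ρ μ ν ≠ 0)
    {β : G → ℝ} (hβ : IsBruhatFunction H ρ β) {F : G → 𝕜} (hF : Integrable F ν)
    {φ : G ⧸ H → 𝕜} (hφm : StronglyMeasurable φ) (hφ : Integrable φ μ) :
    ∀ᵐ x₀ ∂ν, Integrable (fun y₀ => (β y₀ : 𝕜) *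
      (cosetKernel H ρ F x₀ (QuotientGroup.mk y₀) * φ (QuotientGroup.mk y₀))) ν := by
  filter_upwards [ae_integrable_cosetKernel_mul H ρ μ ν hc hF hφm hφ] with x₀ hx₀
  have h := integrable_bruhat_smul_comp_mk H ρ μ ν hc hβ hx₀
  refine h.congr (Eventually.of_forall fun y₀ => ?_)
  simp only [RCLike.real_smul_eq_coe_mul]

/-- **Integrability of the outer Bruhat integrand**:
`x̃ ↦ β(x̃) ψ(x̃H) ∫_G β(ỹ) K_F(x̃, ỹH) φ(ỹH) dν(ỹ)` is `ν`-integrable (it is a.e.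
`c⁻¹ β · (ψ S_F φ) ∘ π` up to the constant). [folklore] -/
theorem integrable_bruhat_mul_mul_integral_bruhat_cosetKernel (hc : unfoldingConstant H ρ μ ν ≠ 0)
    {β : G → ℝ} (hβ : IsBruhatFunction H ρ β) {F : G → 𝕜} (hF : Integrable F ν) {φ ψ : G ⧸ H → 𝕜}
    (hφm : StronglyMeasurable φ) (hφ : MemLp φ 2 μ) (hφ1 : Integrable φ μ)
    (hψm : StronglyMeasurable ψ) (hψ : MemLp ψ 2 μ) :
    Integrable (fun x₀ => (β x₀ : 𝕜) * (ψ (QuotientGroup.mk x₀) *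
      ∫ y₀, (β y₀ : 𝕜) * (cosetKernel H ρ F x₀ (QuotientGroup.mk y₀) * φ (QuotientGroup.mk y₀)) ∂ν)) ν := by
  have h0 := integrable_bruhat_smul_comp_mk H ρ μ ν hc hβ
    (integrable_mul_orbitalSmoothing H μ ν hF hφm hφ hψm hψ)
  refine h0.congr ?_
  filter_upwards [ae_comp_mk_of_ae H ρ μ ν hc
    (ae_smul_orbitalSmoothing_eq_integral_cosetKernel_smul H ρ μ ν hF hφm hφ1),
    ae_integrable_cosetKernel_mul H ρ μ ν hc hF hφm hφ1] with x₀ hx₀ hx₀'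
  have h := hx₀ x₀ rfl
  simp only [smul_eq_mul] at h
  rw [NNReal.smul_def, RCLike.real_smul_eq_coe_mul] at h
  rw [integral_eq_smul_integral_bruhat H ρ μ ν hc hβ hx₀', NNReal.smul_def,
    RCLike.real_smul_eq_coe_mul] at h
  simp only [RCLike.real_smul_eq_coe_mul] at h ⊢
  have hc' : ((unfoldingConstant H ρ μ ν : ℝ) : 𝕜) ≠ 0 := by exact_mod_cast hc
  rw [mul_left_cancel₀ hc' h]

end Unfolding

end Literature.NumberTheory.Automorphic
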